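import Literature.AlgebraicGeometry.Resolution.AlterationsSingFitting
import Literature.AlgebraicGeometry.Resolution.SingUnramifiedRing
import Literature.AlgebraicGeometry.Resolution.SemiStableCurvesBaseChange
import Mathlib.AlgebraicGeometry.Morphisms.FiniteType
import HarnessLib

/-!
# `Sing(f) → S` is unramified for a semi-stable curve (de Jong 1996, 2.21) — proof

Topic: `Literature/AlgebraicGeometry/Resolution`. Discharges the named fact
`DeJong1996SingUnramified` of `AlterationsSingFitting.lean` — de Jong 1996, 2.21: "Let `Sing(f) ⊂ X`
be the closed subscheme defined by the first Fitting ideal of the sheaf `Ω_{X/S}`. The morphism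
`Sing(f) → S` is finite, unramified and of finite presentation", the clause UNRAMIFIED at the
stalks (`𝔪_x ⊆ Fitt₁(Ω_{X/S})_x + 𝔪_s 𝒪_{X,x}` and `κ(x)/κ(s)` separable at the points `x` of
`Sing(f)`) — which the paper states without proof (it is The Stacks Project, Tag 0C59, resting on
Tags 0C4D and 0C3I). The proof:

* `IsSemiStableCurve.isRegularLocalRing_or_nonempty_ringEquiv_tensorProduct` — **the fibre
  condition of 2.21 read on an affine chart**: for affine opens `V ⊆ f⁻¹U` of a semi-stable curve
  `f : X → S` and an algebraically closed field `K` over `R = Γ(S, U)`, every maximal ideal `M`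
  of the geometric fibre ring `K ⊗_R Γ(X, V)` is a nonsingular point of a curve or an ordinary
  double point (`(K ⊗_R T)_M` regular of dimension `1`, or with completion `K⟦u, v⟧/(uv)`):
  `Spec(K ⊗_R T) → X ×_S Spec K` is an open immersion (Mathlib `pullbackSpecIso`,
  `Scheme.pullback_map_isOpenImmersion`), closed points stay closed (`X ×_S Spec K` is Jacobson,
  being locally of finite type over `K`), and the condition depends only on the local ring;
* `DeJong1996SingUnramified_holds` — THE DISCHARGE: on affine charts `x ∈ V ⊆ f⁻¹U`, the stalks
  are the localisations `T_𝔮`, `R_𝔭` (Mathlib `IsAffineOpen.isLocalization_stalk`), the stalk of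
  `Fitt₁(Ω_{X/S})` is `Fitt₁(Ω_{T/R}) T_𝔮` (`Literature.RingTheory.FittingIdeal`, Stacks 07ZA), and
  the ring-level statement `SingUnramifiedRing.lean` (`T/Fitt₁` unramified over `R` at `𝔮`, from
  Stacks 0C4D at the closed points of the geometric fibre, `NodeFittingIdeal.lean`) gives both
  clauses, the residue fields being transported along `𝒪_{X,x} ≅ T_𝔮`, `𝒪_{S,s} ≅ R_𝔭`.

## Sources

* A. J. de Jong, *Smoothness, semi-stability and alterations*, Publ. Math. IHÉS 83 (1996), 2.21,
  2.23 (pp. 61–62). [DeJong1996]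
* The Stacks Project, Tags 0C59, 0C4D, 0C3I, 00UW, 02FM. [StacksProject]
-/

noncomputable section

open CategoryTheory CategoryTheory.Limits AlgebraicGeometry TopologicalSpace IsLocalRing
  Literature.RingTheory.FittingIdeal TensorProduct

namespace Literature.AlgebraicGeometry.Resolution

universe u

namespace IsSemiStableCurve

variable {X S : Scheme.{u}} {f : X ⟶ S}

/-- **The fibre condition of a semi-stable curve on an affine chart** (de Jong 1996, 2.21: "all
geometric fibres are connected curves having at most ordinary double points as singularities"):
for affine opens `V ⊆ f⁻¹U`, `R = Γ(S, U)`, `T = Γ(X, V)` and an algebraically closed field `K`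
over `R`, at every maximal ideal `M` of `K ⊗_R T` the local ring `(K ⊗_R T)_M` is regular of
dimension `1` or has completion `K⟦u, v⟧/(uv)`. Indeed `Spec(K ⊗_R T) = Spec T ×_{Spec R} Spec K`
is an open subscheme of the geometric fibre `X ×_S Spec K`, in which the closed point `M` stays
closed (a scheme locally of finite type over a field is Jacobson), with the same local ring.
[cite: DeJong1996, 2.21, p. 61] -/
theorem isRegularLocalRing_or_nonempty_ringEquiv_tensorProduct (hf : IsSemiStableCurve f)
    {U : S.Opens} (hU : IsAffineOpen U) {V : X.Opens} (hV : IsAffineOpen V) (hVU : V ≤ f ⁻¹ᵁ U)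
    (K : Type u) [Field K] [IsAlgClosed K] [Algebra Γ(S, U) K] [Algebra Γ(S, U) Γ(X, V)]
    (hφ : algebraMap Γ(S, U) Γ(X, V) = (f.appLE U V hVU).hom)
    (M : Ideal (K ⊗[Γ(S, U)] Γ(X, V))) [hM : M.IsMaximal] :
    (IsRegularLocalRing (Localization.AtPrime M) ∧ ringKrullDim (Localization.AtPrime M) = 1) ∨
      Nonempty (AdicCompletion (maximalIdeal (Localization.AtPrime M)) (Localization.AtPrime M) ≃+*
        MvPowerSeries (Fin 2) K ⧸
          Ideal.span {(MvPowerSeries.X 0 * MvPowerSeries.X 1 : MvPowerSeries (Fin 2) K)}) := by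
  haveI := hf.locallyOfFinitePresentation
  -- the geometric point `ι : Spec K → Spec R → S`
  let ι : Spec (.of K) ⟶ S := Spec.map (CommRingCat.ofHom (algebraMap Γ(S, U) K)) ≫ hU.fromSpec
  have eq₁ : Spec.map (CommRingCat.ofHom (algebraMap Γ(S, U) K)) ≫ hU.fromSpec =
      𝟙 _ ≫ ι := (Category.id_comp _).symm
  have eq₂ : Spec.map (CommRingCat.ofHom (algebraMap Γ(S, U) Γ(X, V))) ≫ hU.fromSpec =
      hV.fromSpec ≫ f := by
    rw [hφ, CommRingCat.ofHom_hom]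
    exact IsAffineOpen.SpecMap_appLE_fromSpec f hU hV hVU
  -- the open immersion `Spec (K ⊗ T) → X ×_S Spec K`
  let j : Spec (.of (K ⊗[Γ(S, U)] Γ(X, V))) ⟶ pullback f ι :=
    (pullbackSpecIso Γ(S, U) K Γ(X, V)).inv ≫
      pullback.map _ _ ι f (𝟙 _) hV.fromSpec hU.fromSpec eq₁ eq₂ ≫ (pullbackSymmetry ι f).hom
  -- the closed point `M` and its (closed) image
  let m : Spec (.of (K ⊗[Γ(S, U)] Γ(X, V))) := ⟨M, hM.isPrime⟩
  have hm : IsClosed ({m} : Set (Spec (.of (K ⊗[Γ(S, U)] Γ(X, V))))) :=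
    (PrimeSpectrum.isClosed_singleton_iff_isMaximal m).mpr hM
  haveI : JacobsonSpace ↥(pullback f ι) :=
    LocallyOfFiniteType.jacobsonSpace (pullback.snd f ι)
  have hz : IsClosed ({j m} : Set ↥(pullback f ι)) := by
    have h := j.isOpenEmbedding.preimage_closedPoints
    have hm' : m ∈ closedPoints (Spec (.of (K ⊗[Γ(S, U)] Γ(X, V)))) := hm
    rw [← h] at hm'
    exact hm'
  -- the fibre condition at `j m`, transported along `𝒪_{X_K, j m} ≅ 𝒪_{Spec(K ⊗ T), m} ≅ (K ⊗ T)_M`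
  have hcond := hf.isRegularLocalRing_or_isOrdinaryDoublePoint K ι (j m) hz
  let e₁ : (pullback f ι).presheaf.stalk (j m) ≃+* (Spec (.of (K ⊗[Γ(S, U)] Γ(X, V)))).presheaf.stalk m :=
    (asIso (j.stalkMap m)).commRingCatIsoToRingEquiv
  let e₂ : (Spec (.of (K ⊗[Γ(S, U)] Γ(X, V)))).presheaf.stalk m ≃+* Localization.AtPrime M :=
    (StructureSheaf.stalkIso (K ⊗[Γ(S, U)] Γ(X, V)) m).toRingEquiv.symm
  let e := e₁.trans e₂
  rcases hcond with ⟨hreg, hdim⟩ | hnode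
  · left
    exact ⟨IsRegularLocalRing.of_ringEquiv e, by rw [← ringKrullDim_eq_of_ringEquiv e]; exact hdim⟩
  · right
    exact ⟨(adicCompletionCongr _ _ e (map_maximalIdeal_of_ringEquiv e)).symm.trans hnode.some⟩

end IsSemiStableCurve

/-! ## The discharge -/

/-- **de Jong 1996, 2.21 — `Sing(f) → S` is unramified, for every semi-stable curve
`f : X → S`**, stalkwise: at a point `x` with `Fitt₁(Ω_{X/S})_x ≠ 𝒪_{X,x}` (i.e. `x ∈ Sing(f)`),
`𝔪_x ⊆ Fitt₁(Ω_{X/S})_x + 𝔪_s 𝒪_{X,x}` and `κ(x)/κ(s)` is separable (Stacks 00UW/02FM: the local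
ring of `Sing(f)` at `x` is unramified over `𝒪_{S,s}`). Proof on affine charts `x ∈ V ⊆ f⁻¹U`,
`R = Γ(S, U)`, `T = Γ(X, V)`, `𝔮 ⊂ T`, `𝔭 ⊂ R` the primes of `x`, `s`: the stalks are `T_𝔮`,
`R_𝔭`, the stalk of the singular scheme is `Fitt₁(Ω_{T/R}) T_𝔮` (Fitting ideals and differentials
commute with localisation), the geometric fibre ring `K ⊗_R T` over `K = κ(𝔭)^alg` is nodal at its
closed points (`IsSemiStableCurve.isRegularLocalRing_or_nonempty_ringEquiv_tensorProduct`), so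
`T/Fitt₁` is unramified over `R` at `𝔮` (`SingUnramifiedRing.lean`: Stacks 0C4D at the nodes,
0C3I, and descent of unramifiedness from the geometric point); the two clauses follow by Stacks
00UW (Mathlib `Algebra.isUnramifiedAt_iff_map_eq`), transported back to the stalks.
[cite: DeJong1996, 2.21, p. 61] -/
theorem DeJong1996SingUnramified_holds : DeJong1996SingUnramified.{u} := by
  intro X S f hf x hne
  haveI := hf.locallyOfFinitePresentation
  -- affine charts `x ∈ V ⊆ f⁻¹ U`
  obtain ⟨_, ⟨U, hU, rfl⟩, hxU, -⟩ :=
    S.isBasis_affineOpens.exists_subset_of_mem_open (Set.mem_univ (f x)) isOpen_univ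
  obtain ⟨_, ⟨V, hV, rfl⟩, hxV, hVU⟩ :=
    X.isBasis_affineOpens.exists_subset_of_mem_open hxU (U.2.preimage f.continuous)
  have hFT : (f.appLE U V hVU).hom.FiniteType :=
    HasRingHomProperty.appLE @LocallyOfFiniteType f inferInstance ⟨U, hU⟩ ⟨V, hV⟩ hVU
  algebraize [(f.appLE U V hVU).hom]
  -- the primes of `x` and `s = f x`
  set p : PrimeSpectrum Γ(S, U) := hU.primeIdealOf ⟨f x, hVU hxV⟩ with hp
  set q : PrimeSpectrum Γ(X, V) := hV.primeIdealOf ⟨x, hxV⟩ with hq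
  have hqp : q.asIdeal.comap (algebraMap Γ(S, U) Γ(X, V)) = p.asIdeal :=
    congr($(IsAffineOpen.comap_primeIdealOf_appLE U hU V hV hVU hxV).1)
  haveI : q.asIdeal.LiesOver p.asIdeal := ⟨hqp.symm⟩
  -- the stalks as localisations of the charts
  letI := S.presheaf.algebra_section_stalk ⟨f x, hVU hxV⟩
  haveI : IsLocalization.AtPrime (S.presheaf.stalk (f x)) p.asIdeal :=
    hU.isLocalization_stalk ⟨f x, hVU hxV⟩
  letI := X.presheaf.algebra_section_stalk ⟨x, hxV⟩
  haveI : IsLocalization.AtPrime (X.presheaf.stalk x) q.asIdeal := hV.isLocalization_stalk ⟨x, hxV⟩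
  letI : Algebra (S.presheaf.stalk (f x)) (X.presheaf.stalk x) := (f.stalkMap x).hom.toAlgebra
  letI : Algebra Γ(S, U) (X.presheaf.stalk x) :=
    ((algebraMap Γ(X, V) (X.presheaf.stalk x)).comp (algebraMap Γ(S, U) Γ(X, V))).toAlgebra
  haveI : IsScalarTower Γ(S, U) Γ(X, V) (X.presheaf.stalk x) :=
    IsScalarTower.of_algebraMap_eq fun _ => rfl
  have hsquare : ∀ r : Γ(S, U), (f.stalkMap x).hom (algebraMap Γ(S, U) (S.presheaf.stalk (f x)) r) =
      algebraMap Γ(X, V) (X.presheaf.stalk x) (algebraMap Γ(S, U) Γ(X, V) r) := by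
    intro r
    change f.stalkMap x (S.presheaf.germ U (f x) (hVU hxV) r) =
      X.presheaf.germ V x hxV (f.appLE U V hVU r)
    rw [Scheme.Hom.germ_stalkMap_apply]
    simp only [Scheme.Hom.appLE, CommRingCat.comp_apply]
    exact (X.presheaf.germ_res_apply (homOfLE hVU) x hxV _).symm
  haveI : IsScalarTower Γ(S, U) (S.presheaf.stalk (f x)) (X.presheaf.stalk x) :=
    IsScalarTower.of_algebraMap_eq fun r => (hsquare r).symm
  -- the stalk of `Sing(f)` is the localisation of `J = Fitt₁(Ω_{T/R})`
  set J : Ideal Γ(X, V) := Module.fittingIdeal Γ(X, V) (Ω[Γ(X, V)⁄Γ(S, U)]) 1 with hJ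
  have hFitt : Scheme.Hom.singFittingIdeal f x = J.map (algebraMap Γ(X, V) (X.presheaf.stalk x)) :=
    Module.fittingIdeal_kaehlerDifferential_isLocalization_isLocalization
      (Bₘ := X.presheaf.stalk x) p.asIdeal.primeCompl (S.presheaf.stalk (f x))
      q.asIdeal.primeCompl 1
  -- `x ∈ Sing(f)` means `J ⊆ 𝔮`
  have hJq : J ≤ q.asIdeal := by
    intro y hyJ
    by_contra hyq
    apply hne
    rw [hFitt]
    exact Ideal.eq_top_of_isUnit_mem _ (Ideal.mem_map_of_mem _ hyJ)
      (IsLocalization.map_units _ (⟨y, hyq⟩ : q.asIdeal.primeCompl))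
  -- the geometric fibre over `K = κ(𝔭)^alg` is nodal at its closed points
  let K := AlgebraicClosure p.asIdeal.ResidueField
  have hA : ∀ (M : Ideal (K ⊗[Γ(S, U)] Γ(X, V))) [M.IsMaximal],
      (IsRegularLocalRing (Localization.AtPrime M) ∧ ringKrullDim (Localization.AtPrime M) = 1) ∨
      Nonempty (AdicCompletion (maximalIdeal (Localization.AtPrime M)) (Localization.AtPrime M) ≃+*
        MvPowerSeries (Fin 2) K ⧸
          Ideal.span {(MvPowerSeries.X 0 * MvPowerSeries.X 1 : MvPowerSeries (Fin 2) K)}) :=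
    fun M _ => hf.isRegularLocalRing_or_nonempty_ringEquiv_tensorProduct hU hV hVU K rfl M
  refine ⟨?_, ?_⟩
  · -- (a) `𝔪_x ⊆ Fitt₁ + 𝔪_s 𝒪_{X,x}`
    have hmx : maximalIdeal (X.presheaf.stalk x) =
        q.asIdeal.map (algebraMap Γ(X, V) (X.presheaf.stalk x)) :=
      (IsLocalization.AtPrime.map_eq_maximalIdeal q.asIdeal (X.presheaf.stalk x)).symm
    have hms : (maximalIdeal (S.presheaf.stalk (f x))).map (f.stalkMap x).hom =
        (p.asIdeal.map (algebraMap Γ(S, U) Γ(X, V))).map (algebraMap Γ(X, V) (X.presheaf.stalk x)) := by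
      rw [← IsLocalization.AtPrime.map_eq_maximalIdeal p.asIdeal (S.presheaf.stalk (f x)),
        Ideal.map_map, Ideal.map_map]
      congr 1
      ext r
      exact hsquare r
    rw [hmx, hFitt, hms, ← Ideal.map_sup, Ideal.map_le_iff_le_comap]
    intro y hy
    obtain ⟨s, hs, hsy⟩ :=
      exists_mul_mem_fittingIdeal_sup_of_geometricFibre K p.asIdeal q.asIdeal hA hJq hy
    exact (IsLocalization.AtPrime.algebraMap_mem_map_iff q.asIdeal _ y).mpr ⟨s, hs, hsy⟩
  · -- (b) `κ(x)/κ(s)` separable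
    letI := Localization.AtPrime.algebraOfLiesOver p.asIdeal q.asIdeal
    haveI hsep := isSeparable_residueField_of_geometricFibre K p.asIdeal q.asIdeal hA hJq
    letI : Algebra (S.residueField (f x)) (X.residueField x) := (f.residueFieldMap x).hom.toAlgebra
    -- `𝒪_{S,s} ≅ R_𝔭`, `𝒪_{X,x} ≅ T_𝔮`
    let εs : S.presheaf.stalk (f x) ≃ₐ[Γ(S, U)] Localization.AtPrime p.asIdeal :=
      IsLocalization.algEquiv p.asIdeal.primeCompl _ _
    let εx : X.presheaf.stalk x ≃ₐ[Γ(X, V)] Localization.AtPrime q.asIdeal :=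
      IsLocalization.algEquiv q.asIdeal.primeCompl _ _
    let e₁ : p.asIdeal.ResidueField ≃+* S.residueField (f x) :=
      IsLocalRing.ResidueField.mapEquiv εs.toRingEquiv.symm
    let e₂ : q.asIdeal.ResidueField ≃+* X.residueField x :=
      IsLocalRing.ResidueField.mapEquiv εx.toRingEquiv.symm
    refine Algebra.IsSeparable.of_equiv_equiv e₁ e₂ ?_
    -- both composites `κ(𝔭) → κ(x)` agree on `R`
    apply Ideal.ResidueField.ringHom_ext
    ext r
    change (f.residueFieldMap x).hom (e₁ (algebraMap Γ(S, U) p.asIdeal.ResidueField r)) =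
      e₂ (algebraMap p.asIdeal.ResidueField q.asIdeal.ResidueField
        (algebraMap Γ(S, U) p.asIdeal.ResidueField r))
    -- left-hand side
    have hl : (f.residueFieldMap x).hom (e₁ (algebraMap Γ(S, U) p.asIdeal.ResidueField r)) =
        residue (X.presheaf.stalk x) (algebraMap Γ(S, U) (X.presheaf.stalk x) r) := by
      rw [IsScalarTower.algebraMap_apply Γ(S, U) (Localization.AtPrime p.asIdeal)
        p.asIdeal.ResidueField]
      change (f.residueFieldMap x).hom (IsLocalRing.ResidueField.mapEquiv εs.toRingEquiv.symm
        (residue _ (algebraMap Γ(S, U) (Localization.AtPrime p.asIdeal) r))) = _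
      rw [IsLocalRing.ResidueField.mapEquiv_apply, IsLocalRing.ResidueField.map_residue]
      change IsLocalRing.ResidueField.map (f.stalkMap x).hom
        (residue _ (εs.symm (algebraMap Γ(S, U) (Localization.AtPrime p.asIdeal) r))) = _
      rw [IsLocalRing.ResidueField.map_residue, AlgEquiv.commutes]
      exact congrArg (residue (X.presheaf.stalk x)) (hsquare r)
    -- right-hand side
    have hr : e₂ (algebraMap p.asIdeal.ResidueField q.asIdeal.ResidueField
        (algebraMap Γ(S, U) p.asIdeal.ResidueField r)) =
        residue (X.presheaf.stalk x) (algebraMap Γ(S, U) (X.presheaf.stalk x) r) := by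
      rw [← IsScalarTower.algebraMap_apply Γ(S, U) p.asIdeal.ResidueField q.asIdeal.ResidueField,
        IsScalarTower.algebraMap_apply Γ(S, U) Γ(X, V) q.asIdeal.ResidueField,
        IsScalarTower.algebraMap_apply Γ(X, V) (Localization.AtPrime q.asIdeal)
          q.asIdeal.ResidueField]
      change IsLocalRing.ResidueField.mapEquiv εx.toRingEquiv.symm
        (residue _ (algebraMap Γ(X, V) (Localization.AtPrime q.asIdeal) _)) = _
      rw [IsLocalRing.ResidueField.mapEquiv_apply, IsLocalRing.ResidueField.map_residue]
      change residue _ (εx.symm (algebraMap Γ(X, V) (Localization.AtPrime q.asIdeal) _)) = _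
      rw [AlgEquiv.commutes, IsScalarTower.algebraMap_apply Γ(S, U) Γ(X, V) (X.presheaf.stalk x)]
    rw [hl, hr]

end Literature.AlgebraicGeometry.Resolution

end
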